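import Mathlib
import Summits.Ventures.HodgeRepro2.T6N5LocalWeilQuotient

/-!
# T6N5LocalWeilQuotientKer — Tier 6, M2 sub-step N5 (t6-p8's half): what the hypotheses of the primed per-place
statements of record FORCE — every conjugate-orthogonal character of `E_v^×` has a kernel of finite index

On the quotient carrier `U(V) = E_v^×/F_v^×` (`T6N5LocalWeilQuotient`), the two hypotheses
`h35 : BFGYYZ2025_Thm3_5 …` (the Epsilon Dichotomy displayed over ALL group homomorphisms `E_v^× →* ℂˣ`) and
`hsm : IsSmoothCompact s` (every vector fixed by a finite-index subgroup) of `N5Local_main_inert_completion_weil'` /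
`N5Local_main_ram_completion_weil'` together imply that EVERY conjugate-orthogonal character `ξ : E_v^× →* ℂˣ`
(continuous or not) has a kernel of finite index (`finiteIndex_ker_of_h35_hsm_*`): a non-zero `α`-isotypic vector
fixed by a finite-index subgroup `H` forces `α|_H = 1`, and `ξ = α ∘ j` is then trivial on the finite-index preimage
of `H`. This is the kernel record of the defect found by t6-p8 (gen 6): the display quantifies over all
homomorphisms where the print's `α` are (continuous) characters of the compact group `K¹`, so on a genuine local field
(whose `E_v^×/F_v^×` has elements of infinite order, `ℂˣ` being divisible) the hypothesis set is jointly
unsatisfiable. The repaired chain (display restricted to smooth `α`) is `T6N5LocalHypSmooth` onward.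
README §8(d): uses an L-value-free non-vanishing device: NO.
-/

namespace Summit.Ventures.HodgeRepro2.T6.N5LocalWeilQuotientKer

open Summit.Ventures.HodgeRepro2 IsDedekindDomain HeightOneSpectrum
  Summit.Ventures.HodgeRepro2.T6.N5LocalDatum Summit.Ventures.HodgeRepro2.T6.N5LocalWeil
  Summit.Ventures.HodgeRepro2.T6.N5LocalCharDatum Summit.Ventures.HodgeRepro2.T6.N5Local
  Summit.Ventures.HodgeRepro2.T6.Hyp Summit.Ventures.HodgeRepro2.T6.N5LocalInertCompletion
  Summit.Ventures.HodgeRepro2.T6.N5LocalOnCompletionWeil Summit.Ventures.HodgeRepro2.T6.N5LocalWeilQuotient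
  Summit.Ventures.HodgeRepro2.T6.N5LocalTateChars Summit.Ventures.HodgeRepro2.T5SmoothIsotypic

noncomputable section

/-- Under the displayed Epsilon Dichotomy, every conjugate-orthogonal character has a non-zero theta-lift for the
line of the sign `ε(χ_W⁻¹·ξ)·ϵ_δ(W)`. -/
theorem exists_theta_of_h35 (D : LocalSignDatum) (h35 : BFGYYZ2025_Thm3_5 D) (ξ : D.Char) (hξ : D.IsCO ξ) :
    ∃ s, D.Theta s ξ :=
  ⟨D.eps (D.χW⁻¹ * ξ) * D.epsdW, (h35 _ ξ hξ).mpr (by rw [mul_assoc, Int.units_mul_self, mul_one])⟩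

/-! ### The generic step: an isotypic vector fixed by `H` kills `α` on `H` -/

section Generic

variable {A : Type} [AddCommGroup A] {V : Type} [AddCommGroup V] [Module ℂ V]

/-- A non-zero `α`-isotypic vector fixed by `H` forces `α|_H = 1`. -/
theorem addChar_eq_one_of_mem_isotypic (ρ : Representation ℂ (Multiplicative A) V) (α : AddChar A ℂ)
    {x : V} (hx : x ∈ isotypic ρ α) (hx0 : x ≠ 0) (H : AddSubgroup A) (hH : x ∈ fixedBy ρ H) :
    ∀ a ∈ H, α a = 1 := by
  intro a ha
  have h1 : ρ (Multiplicative.ofAdd a) x = α a • x := hx a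
  have h2 : ρ (Multiplicative.ofAdd a) x = x := hH a ha
  have h3 : (α a - 1) • x = 0 := by
    rw [sub_smul, one_smul, ← h1, h2, sub_self]
  rcases smul_eq_zero.mp h3 with h | h
  · exact sub_eq_zero.mp h
  · exact absurd h hx0

/-- A character of a group `G` inflated from `α : AddChar A ℂ` through a surjective `j : G →* Multiplicative A`
has a kernel of finite index as soon as `α` kills a finite-index subgroup of `A`. -/
theorem finiteIndex_ker_of_eq_one_on {G : Type} [Group G] (j : G →* Multiplicative A)
    (hj : Function.Surjective j) (α : AddChar A ℂ) (ξ : G →* ℂˣ)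
    (hξ : ∀ x, ((ξ x : ℂˣ) : ℂ) = α (Multiplicative.toAdd (j x)))
    (H : AddSubgroup A) [hH : H.FiniteIndex] (hα : ∀ a ∈ H, α a = 1) : ξ.ker.FiniteIndex := by
  have hle : (AddSubgroup.toSubgroup H).comap j ≤ ξ.ker := by
    intro x hx
    rw [MonoidHom.mem_ker]
    apply Units.ext
    rw [hξ x, Units.val_one]
    exact hα _ hx
  haveI : (AddSubgroup.toSubgroup H).FiniteIndex := (AddSubgroup.finiteIndex_toSubgroup_iff H).mpr hH
  haveI : ((AddSubgroup.toSubgroup H).comap j).FiniteIndex := by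
    refine Subgroup.finiteIndex_iff.mpr ?_
    rw [Subgroup.index_comap_of_surjective _ hj]
    exact Subgroup.finiteIndex_iff.mp inferInstance
  exact Subgroup.finiteIndex_of_le hle

end Generic

/-! ### The quotient carrier `E_v^×/F_v^×` -/

variable {K : Type} [Field K] [NumberField K] (v : HeightOneSpectrum (NumberField.RingOfIntegers K))
  {L : Type} [Field L] [NumberField L] [Algebra K L] (w : HeightOneSpectrum (NumberField.RingOfIntegers L))
  [w.asIdeal.LiesOver v.asIdeal]
  [ContinuousSMul (v.adicCompletion K) (w.adicCompletion L)]
  [IsScalarTower K (v.adicCompletion K) (w.adicCompletion L)]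

omit [ContinuousSMul (v.adicCompletion K) (w.adicCompletion L)]
  [IsScalarTower K (v.adicCompletion K) (w.adicCompletion L)] in
/-- The quotient map `E_v^× → E_v^×/F_v^×` is surjective. -/
theorem toMulAdd_surjective : Function.Surjective (toMulAdd v w) := by
  intro q
  obtain ⟨x, hx⟩ := QuotientGroup.mk_surjective (Additive.toMul (Multiplicative.toAdd q))
  refine ⟨x, ?_⟩
  show Multiplicative.ofAdd (Additive.ofMul (x : (w.adicCompletion L)ˣ ⧸ Fsub v w)) = q
  rw [hx, ofMul_toMul, ofAdd_toAdd]

omit [ContinuousSMul (v.adicCompletion K) (w.adicCompletion L)]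
  [IsScalarTower K (v.adicCompletion K) (w.adicCompletion L)] in
/-- `ofOneQ α` is the inflation of `α` through the quotient map. -/
theorem ofOneQ_eq (α : AddChar (QuotA v w) ℂ) (x : (w.adicCompletion L)ˣ) :
    ((ofOneQ v w α x : ℂˣ) : ℂ) = α (Multiplicative.toAdd (toMulAdd v w x)) :=
  ofOneQ_apply v w α x

/-! ### The forced consequence on the two per-place statements of record -/

section Inert

variable (h2 : Module.finrank (v.adicCompletion K) (w.adicCompletion L) = 2)
  {ϖ : v.adicCompletionIntegers K} (hϖ : Irreducible ϖ)
  (hϖS : Irreducible (algebraMap (v.adicCompletionIntegers K) (w.adicCompletionIntegers L) ϖ))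
  (σ : Gal(w.adicCompletion L/v.adicCompletion K)) (hσ : σ ≠ 1)
  (P : TateParams (w.adicCompletion L)ˣ (PsiC w) ℝ) (ψδ : PsiC w)
  (hK : ∀ a : v.adicCompletion K, ψδ.1 (algebraMap (v.adicCompletion K) (w.adicCompletion L) a) = 1)
  (R : WeilRep v w)

omit [IsScalarTower K (v.adicCompletion K) (w.adicCompletion L)] in
/-- THE FORCED CONSEQUENCE at an inert place: a character `ξ` of `E_v^×` with a non-zero theta-lift in the sense of
the defined predicate (`thetaOf s ξ`) in a smooth (`IsSmoothCompact s`) Weil representation over `E_v^×/F_v^×` has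
a kernel of finite index. -/
theorem finiteIndex_ker_of_thetaOf_inert (s : ℤˣ) (ξ : (w.adicCompletion L)ˣ →* ℂˣ)
    (hθ : (mkInertWeil v w h2 hϖ hϖS σ hσ P ψδ hK (toCarrier v w R)).toWeil.thetaOf s ξ)
    (hsm : (mkInertWeil v w h2 hϖ hϖS σ hσ P ψδ hK (toCarrier v w R)).toWeil.IsSmoothCompact s) :
    ξ.ker.FiniteIndex := by
  obtain ⟨α, hα, hne⟩ := hθ
  obtain ⟨x, hx, hx0⟩ := (Submodule.ne_bot_iff _).mp hne
  obtain ⟨H, ⟨hH⟩, hxH⟩ := hsm x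
  haveI : H.FiniteIndex := AddSubgroup.finiteIndex_of_finite_quotient
  have hα1 := addChar_eq_one_of_mem_isotypic (R.ωWeil s) α hx hx0 H hxH
  have hξ : ξ = ofOneQ v w α := hα.symm
  subst hξ
  exact finiteIndex_ker_of_eq_one_on (toMulAdd v w) (toMulAdd_surjective v w) α _ (ofOneQ_eq v w α) H hα1

omit [IsScalarTower K (v.adicCompletion K) (w.adicCompletion L)] in
/-- `h35` and `hsm` of `N5Local_main_inert_completion_weil'` force EVERY conjugate-orthogonal character of `E_v^×`
(continuous or not) to have a kernel of finite index. -/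
theorem finiteIndex_ker_of_h35_hsm_inert
    (h35 : BFGYYZ2025_Thm3_5
      (mkInertWeil v w h2 hϖ hϖS σ hσ P ψδ hK (toCarrier v w R)).toWeil.toLocalSignDatum)
    (hsm : ∀ s, (mkInertWeil v w h2 hϖ hϖS σ hσ P ψδ hK (toCarrier v w R)).toWeil.IsSmoothCompact s)
    (ξ : (w.adicCompletion L)ˣ →* ℂˣ)
    (hξ : (mkInertWeil v w h2 hϖ hϖS σ hσ P ψδ hK (toCarrier v w R)).toWeil.toLocalSignDatum.IsCO ξ) :
    ξ.ker.FiniteIndex := by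
  obtain ⟨s, hθ⟩ := exists_theta_of_h35 _ h35 ξ hξ
  exact finiteIndex_ker_of_thetaOf_inert v w h2 hϖ hϖS σ hσ P ψδ hK R s ξ hθ (hsm s)

end Inert

section Ram

variable (h2 : Module.finrank (v.adicCompletion K) (w.adicCompletion L) = 2)
  {π : w.adicCompletionIntegers L} (hπ : Irreducible π)
  (σ : Gal(w.adicCompletion L/v.adicCompletion K)) (hσ : σ ≠ 1)
  (P : TateParams (w.adicCompletion L)ˣ (PsiC w) ℝ) (ψδ : PsiC w)
  (R : WeilRep v w)

omit [ContinuousSMul (v.adicCompletion K) (w.adicCompletion L)]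
  [IsScalarTower K (v.adicCompletion K) (w.adicCompletion L)] in
/-- THE FORCED CONSEQUENCE at a ramified place. -/
theorem finiteIndex_ker_of_thetaOf_ram (s : ℤˣ) (ξ : (w.adicCompletion L)ˣ →* ℂˣ)
    (hθ : (mkRamWeil v w h2 hπ σ hσ P ψδ (toCarrier v w R)).toWeil.thetaOf s ξ)
    (hsm : (mkRamWeil v w h2 hπ σ hσ P ψδ (toCarrier v w R)).toWeil.IsSmoothCompact s) :
    ξ.ker.FiniteIndex := by
  obtain ⟨α, hα, hne⟩ := hθ
  obtain ⟨x, hx, hx0⟩ := (Submodule.ne_bot_iff _).mp hne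
  obtain ⟨H, ⟨hH⟩, hxH⟩ := hsm x
  haveI : H.FiniteIndex := AddSubgroup.finiteIndex_of_finite_quotient
  have hα1 := addChar_eq_one_of_mem_isotypic (R.ωWeil s) α hx hx0 H hxH
  have hξ : ξ = ofOneQ v w α := hα.symm
  subst hξ
  exact finiteIndex_ker_of_eq_one_on (toMulAdd v w) (toMulAdd_surjective v w) α _ (ofOneQ_eq v w α) H hα1

omit [ContinuousSMul (v.adicCompletion K) (w.adicCompletion L)]
  [IsScalarTower K (v.adicCompletion K) (w.adicCompletion L)] in
/-- `h35` and `hsm` of `N5Local_main_ram_completion_weil'` force EVERY conjugate-orthogonal character of `E_v^×`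
(continuous or not) to have a kernel of finite index. -/
theorem finiteIndex_ker_of_h35_hsm_ram
    (h35 : BFGYYZ2025_Thm3_5 (mkRamWeil v w h2 hπ σ hσ P ψδ (toCarrier v w R)).toWeil.toLocalSignDatum)
    (hsm : ∀ s, (mkRamWeil v w h2 hπ σ hσ P ψδ (toCarrier v w R)).toWeil.IsSmoothCompact s)
    (ξ : (w.adicCompletion L)ˣ →* ℂˣ)
    (hξ : (mkRamWeil v w h2 hπ σ hσ P ψδ (toCarrier v w R)).toWeil.toLocalSignDatum.IsCO ξ) :
    ξ.ker.FiniteIndex := by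
  obtain ⟨s, hθ⟩ := exists_theta_of_h35 _ h35 ξ hξ
  exact finiteIndex_ker_of_thetaOf_ram v w h2 hπ σ hσ P ψδ R s ξ hθ (hsm s)

end Ram

end

end Summit.Ventures.HodgeRepro2.T6.N5LocalWeilQuotientKer
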